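import Summits.CriticalPhenomena.PercolationContinuityZ3.Theorems.Transplant.KNCellsBoxProdZ2ConcG
import Summits.CriticalPhenomena.PercolationContinuityZ3.Theorems.Transplant.BoxProdZ2TubeLevels
import HarnessLib

/-!
# Design (D), residue `hout_of_valid`, INSTANCE HALF for the concentric geometry `cellGeomCG`: a vertex of `E_{v,x} ∪ H_{x,y}` (resp. of the
# root world / of `E^far`) adjacent in `X □ ℤ²` to a vertex of the fibre tube `B_X(w₀, E) × ℤ²` is TUBE-adjacent, as soon as the radii of the
# between-box, the cube and the corridor profile are `≤ E` (the schedule facts of `concRadiiGB`; generic half: `KNCells2SepQ.mem_of_adj_fresh`)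

builds on p205010 (kernel theorem, internal audit signed; external expert review pending) — nothing in this file uses p205010.
Lane `prim-bschramm`, seat `prim-bschramm-p2` (residue hout_of_valid, lead 14:35:13Z); helper file (`--supports stmt-CriticalPhenomena-4575`).

* `tube_adj_of_fst_mem` — an `X □ ℤ²`-edge whose two endpoints have fibre in `π` is a `tubeGraph X π`-edge (definitional);
* `fst_mem_of_adj_prod` — if `x ∈ B_X(w₀, R) × P` with `R ≤ E` is adjacent to `v` with `v.1 ∈ B_X(w₀, E)`, then `x.1 ∈ B_X(w₀, E)`;
  `fst_mem_of_adj_stair` — the same for a staircase set with profile `≤ E`;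
* **`tube_adj_of_mem_Ewv_Hfull`** — the `hout` side-condition of `isSubbox_Wcor_graph` in `tubeGraph X (B_X(w₀,E))` for the hreach habitat of
  `cellGeomCG` (given `rB α v δ ≤ E`, `rQ α (v+δ) ≤ E`, `ρ β (v+δ) du · ≤ E`); `tube_adj_of_mem_cut` (the root world cut to the tube);
  **`tube_adj_of_mem_Ewv_Efar`** — the same for the `cond_j` habitat `E^far_β(x,du)` in `tubeGraph X (B_X(w₀,F))` (given `rE β x du ≤ F`; the cube
  `Q_x` is fatter than the far box, but its planar sites are off the fresh far region, so a cube neighbour is joined by a planar edge).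
[cite: KozmaNitzan2024, §4 p. 17 (subbox), p. 31]
-/

noncomputable section

open scoped Classical

namespace Summit.CriticalPhenomena.PercolationContinuityZ3.Theorems

namespace Transplant

namespace BoxProdZ2

open Literature.Probability.Percolation Literature.Probability.LatticeModels SimpleGraph KNCells

variable {W : Type} [DecidableEq W] (X : SimpleGraph W) [X.LocallyFinite]

omit [DecidableEq W] [X.LocallyFinite] in
/-- An `X □ ℤ²`-edge with both fibres in `π` is a tube edge. [folklore] -/
theorem tube_adj_of_fst_mem {π : Finset W} {x v : W × Site 2} (hadj : (X □ zdGraph 2).Adj x v) (hx : x.1 ∈ π) (hv : v.1 ∈ π) :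
    (tubeGraph X π).Adj x v := (tubeGraph_adj X).2 ⟨hadj, hx, hv⟩

omit [DecidableEq W] in
/-- **Fibre control across an edge from a product set**: if `x ∈ B_X(w₀,R) × P` (`R ≤ E`) is adjacent to `v` with `v.1 ∈ B_X(w₀,E)`, then
`x.1 ∈ B_X(w₀,E)` (a planar edge keeps the fibre; a fibre edge keeps `x` in its own ball). [folklore] -/
theorem fst_mem_of_adj_prod {w₀ : W} {R E : ℕ} (hRE : R ≤ E) {P : Finset (Site 2)} {x v : W × Site 2} (hx : x ∈ ballFin X w₀ R ×ˢ P)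
    (_hadj : (X □ zdGraph 2).Adj x v) (_hv : v.1 ∈ ballFin X w₀ E) : x.1 ∈ ballFin X w₀ E :=
  ballFin_mono X w₀ hRE (Finset.mem_product.1 hx).1

/-- The same for a staircase set whose profile is `≤ E` on its planar support. [folklore] -/
theorem fst_mem_of_adj_stair {w₀ : W} {E : ℕ} {ρ : Site 2 → ℕ} {P : Finset (Site 2)} (hρ : ∀ t ∈ P, ρ t ≤ E) {x v : W × Site 2}
    (hx : x ∈ stair X w₀ ρ P) (_hadj : (X □ zdGraph 2).Adj x v) (_hv : v.1 ∈ ballFin X w₀ E) : x.1 ∈ ballFin X w₀ E := by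
  obtain ⟨hP, hB⟩ := (mem_stair X).1 hx
  exact ballFin_mono X w₀ (hρ _ hP) hB

variable {X}
variable {C : PCells} {w₀ : W} {Λ : ConcRadiiG}

/-- **The `hout` side-condition of the hreach habitat of `cellGeomCG` in the tube graph**: with `E` an upper bound for the between-box radius
`rB α v δ`, the cube radius `rQ α (v+δ)` and the corridor profile `ρ β (v+δ) du ·`, every vertex of `E_{v,x} ∪ H_{x,·}` adjacent to a vertex of
the tube `B_X(w₀,E) × ℤ²` is tube-adjacent. (With `KNCells2SepQ.mem_of_adj_fresh` this is `hout` of `isSubbox_Wcor_graph`.) [cite: KozmaNitzan2024, §4 p. 31] -/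
theorem tube_adj_of_mem_Ewv_Hfull {α β : ℕ} {v : Site 2} {δ du : MDir} {E : ℕ}
    (hB : Λ.rB α v δ ≤ E) (hQ : Λ.rQ α (v + stepVec δ) ≤ E) (hρ : ∀ ℓ, Λ.ρ β (v + stepVec δ) du ℓ ≤ E)
    {x u : W × Site 2} (hx : x ∈ (cellGeomCG X C w₀ Λ).Ewv α v δ ∪ (faceDataCG X C w₀ Λ).Hfull β (v + stepVec δ) du)
    (hu : u.1 ∈ ballFin X w₀ E) (hadj : (X □ zdGraph 2).Adj x u) : (tubeGraph X (ballFin X w₀ E)).Adj x u := by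
  refine tube_adj_of_fst_mem X hadj ?_ hu
  rcases Finset.mem_union.1 hx with hx | hx
  · rw [CellGeom.Ewv] at hx
    rcases Finset.mem_union.1 hx with hx | hx
    · exact fst_mem_of_adj_prod X hB hx hadj hu
    · exact fst_mem_of_adj_prod X hQ hx hadj hu
  · exact fst_mem_of_adj_stair X (fun t _ => hρ _) hx hadj hu

omit [X.LocallyFinite] in
/-- **The `hout` side-condition of the root world** `Q_{a₀,0} ∪ E_{a₀,0,du}` cut to the tube `B_X(w₀,F) × ℤ²`: trivially every vertex of the cut
world has fibre in the tube. (For `hQ0_of_chain_sub` with `U' := U0root du ∩ tube`.) [folklore] -/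
theorem tube_adj_of_mem_cut {π : Finset W} {U : Finset (W × Site 2)} {x u : W × Site 2} (hx : x ∈ U.filter fun y => y.1 ∈ π)
    (hu : u.1 ∈ π) (hadj : (X □ zdGraph 2).Adj x u) : (tubeGraph X π).Adj x u :=
  tube_adj_of_fst_mem X hadj (Finset.mem_filter.1 hx).2 hu

/-- **The `hout` side-condition of the `cond_j` habitat** `E^far_β(x,du)` (`x = v + δ`) in the tube `B_X(w₀,F) × ℤ²`: a vertex of
`E_{v,x} ∪ E^far_β(x,du)` adjacent to a vertex `u` of the tube whose planar site lies OFF the planar supports of `E_{v,x}` (the fresh far region is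
planarly disjoint from `Btw(v,x) ∪ Q_x` — `SepGeom.Ewv_disjoint_Efar`) is tube-adjacent, given `rE β x du ≤ F`: a fibre edge would keep the planar
site, so an `E_{v,x}`-neighbour is joined by a planar edge and has the same fibre. [cite: KozmaNitzan2024, §4 p. 31] -/
theorem tube_adj_of_mem_Ewv_Efar {α β : ℕ} {v : Site 2} {δ du : MDir} {F : ℕ}
    (hE : Λ.rE β (v + stepVec δ) du ≤ F)
    {x u : W × Site 2} (hx : x ∈ (cellGeomCG X C w₀ Λ).Ewv α v δ ∪ (cellGeomCG X C w₀ Λ).Efar β (v + stepVec δ) du)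
    (hu2 : u.2 ∉ C.Btw v δ ∪ C.Q (v + stepVec δ)) (hu : u.1 ∈ ballFin X w₀ F) (hadj : (X □ zdGraph 2).Adj x u) :
    (tubeGraph X (ballFin X w₀ F)).Adj x u := by
  refine tube_adj_of_fst_mem X hadj ?_ hu
  rcases Finset.mem_union.1 hx with hx | hx
  · -- `x ∈ E_{v,x}`: the edge is planar (a fibre edge keeps the planar site, which is off `Btw ∪ Q`)
    rcases (SimpleGraph.boxProd_adj).1 hadj with ⟨-, h2⟩ | ⟨-, h1⟩
    · exfalso
      apply hu2
      rw [← h2]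
      rw [CellGeom.Ewv] at hx
      rcases Finset.mem_union.1 hx with hx | hx
      · exact Finset.mem_union_left _ (Finset.mem_product.1 hx).2
      · exact Finset.mem_union_right _ (Finset.mem_product.1 hx).2
    · rw [h1]; exact hu
  · exact fst_mem_of_adj_prod X hE hx hadj hu

end BoxProdZ2

end Transplant

end Summit.CriticalPhenomena.PercolationContinuityZ3.Theorems

end
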